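import Mathlib
import HarnessLib
import Literature.Analysis.FluidPDE.TaoAveragedNondegeneracy
import Literature.Analysis.FluidPDE.VectorCalculus
import Summits.NavierStokesRegularity.NavierStokesRegularity.Theorems.UnthreadedDoorNetFluxDefs
import Summits.NavierStokesRegularity.NavierStokesRegularity.Theorems.UnthreadedDoorNetFluxEnvelopeDefs
import Summits.NavierStokesRegularity.NavierStokesRegularity.Theorems.UnthreadedDoorNetFluxEnvelopeToolkit
import Summits.NavierStokesRegularity.NavierStokesRegularity.Theorems.UnthreadedDoorNetFluxEnvelopeRegularity
import Summits.NavierStokesRegularity.NavierStokesRegularity.Theorems.UnthreadedDoorNetFluxNearCentreComparison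
import Summits.NavierStokesRegularity.NavierStokesRegularity.Theorems.UnthreadedDoorNetFluxOscLeVorticity
import Summits.NavierStokesRegularity.NavierStokesRegularity.Theorems.UnthreadedDoorNetFluxExtremalHeadCore
import Summits.NavierStokesRegularity.NavierStokesRegularity.Theorems.UnthreadedDoorNetFluxExtremalHeadDeriv
import Summits.NavierStokesRegularity.NavierStokesRegularity.Theorems.UnthreadedDoorNetFluxExtremalHeadContinuity

/-!
# Route `UnthreadedDoor`, crux `PoloidalLiouville` (stmt-NavierStokesRegularity-1222), WALL W1 — netflux line:
# **NF-1a `NetFlux.ExtremalHeadEMF` (hinge (a), the research stub `stub_extremalHeadEMF`) IS A THEOREM**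

`extremalHeadEMF : ExtremalHeadEMF` proves, BY NAME, the Theorems-side twin (`UnthreadedDoorNetFluxEnvelopeDefs`, p662148,
verbatim copy of §0 of the registered line `Cruxes/PoloidalLiouville/Lines/netflux_typei_gap.lean`, planner ns-idea-14) of the
line's hardest registered stub NF-1a: for window data `v, T` (smooth; `T` off the centre), a `C¹` head `P(t,·)` off `x₀` with the
tangential relation `∇P − m∇T ∥ (x − x₀)`, `m = ⟪v, x − x₀⟫`, `‖v(t,·)‖ ≤ V(t)`, and every sphere saddle-free, the extremal head
difference `I(t,r) = P(t,x⁺) − P(t,x⁻)` is (i) choice-independent, (ii) jointly continuous on the window, (iii) locally Lipschitz in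
`r`, (iv) bounded by `V · netFlux`, (v) has a.e. slope `≤ sup_{argmax} ∂_r P − inf_{argmin} ∂_r P`.
In the line: `theorem stub_extremalHeadEMF : ExtremalHeadEMF := Theorems.PoloidalLiouville.NetFlux.extremalHeadEMF`
(definitional unfolding over the §4 `rfl`-twins, as for NF-1bᵛ/NF-6/NF-4ᵛ).

Proof architecture (ARM A ns-exp-scalarLiouville g4; all inputs are tree theorems with standard axioms):
(Λ) `levelLipschitz` (unicoherence of `S²` p671593 → connected level sets → Sard on the sphere p672064 → local level chart
p672756 → level constancy + last crossing p673309 → p673753); slice lemmas (i),(iii),(iv) p674150 and (v) (Danskin)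
`…ExtremalHeadDeriv`; (ii) here (`continuousOn_head_diff`): NO line integrals — the great-circle oscillation lemma
`sub_le_pi_mul_of_norm_cross_gradient_le` (NF-0 file p660776) applied to `D = P_t − P_{t₁} ∘ σ` (`σ` the radial scaling
`S_r → S_{r₁}`), whose tangential gradient `Θ(t,r,ξ) − Θ(t₁,r₁,ξ)`, `Θ = r·m·(∇T × ξ)`, is uniformly small by the tube lemma
over the compact unit sphere, plus (Λ) on `S_{r₁}` and the uniform closeness of `T_t(x₀ + rξ)` to `T_{t₁}(x₀ + r₁ξ)`.

HONEST FRAME: a stratum stub of one crux idea; `PoloidalLiouville` (1222), the wall stub `stub_scalarLiouville`, the rung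
`UnimodalScalarLiouvilleTypeI` (still needs NF-1cᵛ) and Navier–Stokes regularity are NOT proved here.
`--supports stmt-NavierStokesRegularity-1222 --as helper`.  [folklore]
-/

noncomputable section

-- the summit and its single sub-problem share the name (CONVENTIONS §1)
set_option linter.dupNamespace false

open Set Function Filter Topology InnerProductSpace MeasureTheory Metric
open scoped RealInnerProductSpace ContDiff

namespace Summit.NavierStokesRegularity.NavierStokesRegularity.Theorems.PoloidalLiouville.NetFlux

open Literature.Analysis Literature.Analysis.FluidPDE

/-! ### (ii) Joint continuity of the extremal head difference -/

section Window

variable {v : ℝ → E3 → E3} {x₀ : E3} {T P : ℝ → E3 → ℝ} {V : ℝ → ℝ} {t₀ : ℝ}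

/-- The gradient of a difference at a point of differentiability. [folklore] -/
theorem gradient_sub_of_differentiableAt {f g : E3 → ℝ} {x : E3} (hf : DifferentiableAt ℝ f x)
    (hg : DifferentiableAt ℝ g x) : gradient (fun z => f z - g z) x = gradient f x - gradient g x := by
  have e : ∀ φ : E3 → ℝ, gradient φ x = (InnerProductSpace.toDual ℝ E3).symm (fderiv ℝ φ x) := fun _ => rfl
  have hd : HasFDerivAt (fun z => f z - g z) (fderiv ℝ f x - fderiv ℝ g x) x := hf.hasFDerivAt.sub hg.hasFDerivAt
  rw [e, e, e, hd.fderiv, map_sub]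

/-- **(ii) JOINT CONTINUITY of the extremal head difference** `(t,r) ↦ P(t, x⁺(t,r)) − P(t, x⁻(t,r))` on `]t₀,0[ × ]0,∞[`, for ANY
selection of extremisers (see the module docstring for the mechanism; no regularity of `P` in `t` is used). [folklore] -/
theorem continuousOn_head_diff (hv : ContDiffOn ℝ (⊤ : ℕ∞) (uncurry v) (Ioo t₀ 0 ×ˢ univ))
    (hT : ContDiffOn ℝ (⊤ : ℕ∞) (uncurry T) (Ioo t₀ 0 ×ˢ ({x₀}ᶜ : Set E3)))
    (hP : ∀ t ∈ Ioo t₀ 0, ContDiffOn ℝ 1 (P t) ({x₀}ᶜ : Set E3))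
    (hV : ∀ t ∈ Ioo t₀ 0, ∀ x, ‖v t x‖ ≤ V t)
    (hcross : ∀ t ∈ Ioo t₀ 0, ∀ x, x ≠ x₀ →
        cross (gradient (P t) x - (⟪v t x, x - x₀⟫) • gradient (T t) x) (x - x₀) = 0)
    (hU : ∀ t ∈ Ioo t₀ 0, ∀ r > 0, IsUnimodalSphere (T t) x₀ r)
    {sel : ℝ → ℝ → E3 × E3}
    (hsel : ∀ t ∈ Ioo t₀ 0, ∀ r > 0, (sel t r).1 ∈ sphArgmax (T t) x₀ r ∧ (sel t r).2 ∈ sphArgmin (T t) x₀ r) :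
    ContinuousOn (fun p : ℝ × ℝ => P p.1 (sel p.1 p.2).1 - P p.1 (sel p.1 p.2).2) (Ioo t₀ 0 ×ˢ Ioi 0) := by
  set Dset : Set (ℝ × ℝ) := Ioo t₀ 0 ×ˢ Ioi 0 with hDset
  rintro ⟨t₁, r₁⟩ ⟨ht₁, hr₁⟩
  have hr₁' : 0 < r₁ := hr₁
  -- slice facts
  have hvs : ∀ t ∈ Ioo t₀ 0, ContDiff ℝ (⊤ : ℕ∞) (v t) := fun t ht => contDiff_slice_of_uncurry hv ht
  have hTs : ∀ t ∈ Ioo t₀ 0, ContDiffOn ℝ (⊤ : ℕ∞) (T t) ({x₀}ᶜ : Set E3) := fun t ht => contDiffOn_slice_compl hT ht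
  have hTc : ∀ t ∈ Ioo t₀ 0, ∀ {ρ : ℝ}, 0 < ρ → ContinuousOn (T t) (Metric.sphere x₀ ρ) := fun t ht ρ hρ =>
    continuousOn_sphere_of_continuousOn_compl (hTs t ht).continuousOn hρ
  have hV₁ : 0 ≤ V t₁ := (norm_nonneg _).trans (hV t₁ ht₁ x₀)
  -- the two continuous fields on `(parameters) × (unit directions)`
  set S' : Set ((ℝ × ℝ) × E3) := Dset ×ˢ ({0}ᶜ : Set E3) with hS'
  set A : (ℝ × ℝ) × E3 → ℝ × E3 := fun z => (z.1.1, x₀ + z.1.2 • z.2) with hA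
  have hAc : Continuous A := (continuous_fst.comp continuous_fst).prodMk
    (continuous_const.add ((continuous_snd.comp continuous_fst).smul continuous_snd))
  have hAmaps : MapsTo A S' (Ioo t₀ 0 ×ˢ ({x₀}ᶜ : Set E3)) := by
    rintro ⟨⟨t, r⟩, ξ⟩ ⟨⟨ht, hr⟩, hξ⟩
    refine ⟨ht, ?_⟩
    show x₀ + r • ξ ∈ ({x₀}ᶜ : Set E3)
    rw [mem_compl_singleton_iff, Ne, add_eq_left]
    exact smul_ne_zero (ne_of_gt hr) hξ
  have hAmaps' : MapsTo A S' (Ioo t₀ 0 ×ˢ (univ : Set E3)) := fun z hz => ⟨(hAmaps hz).1, mem_univ _⟩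
  set Φ₂ : (ℝ × ℝ) × E3 → ℝ := fun z => T z.1.1 (x₀ + z.1.2 • z.2) with hΦ₂
  have hΦ₂c : ContinuousOn Φ₂ S' := hT.continuousOn.comp hAc.continuousOn hAmaps
  set Φ₁ : (ℝ × ℝ) × E3 → E3 := fun z =>
    z.1.2 • (⟪v z.1.1 (x₀ + z.1.2 • z.2), z.1.2 • z.2⟫ • cross (gradient (T z.1.1) (x₀ + z.1.2 • z.2)) z.2) with hΦ₁
  have hΦ₁c : ContinuousOn Φ₁ S' := by
    have hG : ContinuousOn (fun z : (ℝ × ℝ) × E3 => gradient (T z.1.1) (x₀ + z.1.2 • z.2)) S' :=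
      (continuousOn_gradient_family hT).comp hAc.continuousOn hAmaps
    have hvA : ContinuousOn (fun z : (ℝ × ℝ) × E3 => v z.1.1 (x₀ + z.1.2 • z.2)) S' :=
      hv.continuousOn.comp hAc.continuousOn hAmaps'
    have hrξ : Continuous fun z : (ℝ × ℝ) × E3 => z.1.2 • z.2 := (continuous_snd.comp continuous_fst).smul continuous_snd
    have hm : ContinuousOn (fun z : (ℝ × ℝ) × E3 => ⟪v z.1.1 (x₀ + z.1.2 • z.2), z.1.2 • z.2⟫) S' :=
      hvA.inner hrξ.continuousOn
    have hsnd : ContinuousOn (fun z : (ℝ × ℝ) × E3 => z.2) S' := continuous_snd.continuousOn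
    have hcG : ContinuousOn (fun z : (ℝ × ℝ) × E3 => crossCLM (gradient (T z.1.1) (x₀ + z.1.2 • z.2))) S' :=
      crossCLM.continuous.comp_continuousOn hG
    have hcr : ContinuousOn (fun z : (ℝ × ℝ) × E3 => (crossCLM (gradient (T z.1.1) (x₀ + z.1.2 • z.2))) z.2) S' :=
      hcG.clm_apply hsnd
    have hcr' : ContinuousOn (fun z : (ℝ × ℝ) × E3 => cross (gradient (T z.1.1) (x₀ + z.1.2 • z.2)) z.2) S' :=
      hcr.congr fun z _ => by simp only [crossCLM_apply]
    exact (continuous_snd.comp continuous_fst).continuousOn.smul (hm.smul hcr')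
  -- the target
  rw [Metric.continuousWithinAt_iff]
  intro ε hε
  set ε₁ : ℝ := ε / (Real.pi + 4 * V t₁ * r₁ + 1) with hε₁
  have hden : 0 < Real.pi + 4 * V t₁ * r₁ + 1 := by positivity
  have hε₁pos : 0 < ε₁ := div_pos hε hden
  -- uniform closeness over the unit sphere near `(t₁, r₁)`
  have hp₁S : ∀ ξ ∈ Metric.sphere (0 : E3) 1, (((t₁, r₁), ξ) : (ℝ × ℝ) × E3) ∈ S' := by
    intro ξ hξ
    refine ⟨⟨ht₁, hr₁⟩, ?_⟩
    show ξ ∈ ({0}ᶜ : Set E3)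
    rw [mem_compl_singleton_iff]; intro h0
    rw [h0, mem_sphere_iff_norm, sub_zero, norm_zero] at hξ; exact zero_ne_one hξ
  have htube : ∀ᶠ p in 𝓝 (t₁, r₁), ∀ ξ ∈ Metric.sphere (0 : E3) 1, ξ ∈ Metric.sphere (0 : E3) 1 → p ∈ Dset →
      ‖Φ₁ (p, ξ) - Φ₁ ((t₁, r₁), ξ)‖ < ε₁ ∧ |Φ₂ (p, ξ) - Φ₂ ((t₁, r₁), ξ)| < ε₁ := by
    refine isCompact_eventually_forall_sphere fun ξ₀ hξ₀ => ?_
    have hc : ContinuousWithinAt (fun z => (Φ₁ z, Φ₂ z)) S' ((t₁, r₁), ξ₀) :=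
      (hΦ₁c.prodMk hΦ₂c) _ (hp₁S ξ₀ hξ₀)
    have h1 : ∀ᶠ z in 𝓝 (((t₁, r₁), ξ₀) : (ℝ × ℝ) × E3), z ∈ S' →
        dist (Φ₁ z, Φ₂ z) (Φ₁ ((t₁, r₁), ξ₀), Φ₂ ((t₁, r₁), ξ₀)) < ε₁ / 2 :=
      eventually_nhdsWithin_iff.1 (Metric.tendsto_nhds.1 hc (ε₁ / 2) (half_pos hε₁pos))
    have hgc : Continuous (fun z : (ℝ × ℝ) × E3 => (((t₁, r₁), z.2) : (ℝ × ℝ) × E3)) :=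
      continuous_const.prodMk continuous_snd
    have hg : Tendsto (fun z : (ℝ × ℝ) × E3 => (((t₁, r₁), z.2) : (ℝ × ℝ) × E3)) (𝓝 ((t₁, r₁), ξ₀))
        (𝓝 ((t₁, r₁), ξ₀)) :=
      hgc.tendsto ((t₁, r₁), ξ₀)
    have h2 : ∀ᶠ z in 𝓝 (((t₁, r₁), ξ₀) : (ℝ × ℝ) × E3), (((t₁, r₁), z.2) : (ℝ × ℝ) × E3) ∈ S' →
        dist (Φ₁ ((t₁, r₁), z.2), Φ₂ ((t₁, r₁), z.2)) (Φ₁ ((t₁, r₁), ξ₀), Φ₂ ((t₁, r₁), ξ₀)) < ε₁ / 2 :=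
      hg.eventually h1
    filter_upwards [h1, h2] with z hz1 hz2 hξ hp
    have hzS : z ∈ S' := ⟨hp, (hp₁S z.2 hξ).2⟩
    have d1 := hz1 hzS
    have d2 := hz2 (hp₁S z.2 hξ)
    have d := (dist_triangle_right (Φ₁ z, Φ₂ z) (Φ₁ ((t₁, r₁), z.2), Φ₂ ((t₁, r₁), z.2))
      (Φ₁ ((t₁, r₁), ξ₀), Φ₂ ((t₁, r₁), ξ₀))).trans_lt (by linarith : _ < ε₁)
    rw [Prod.dist_eq, max_lt_iff, dist_eq_norm, Real.dist_eq] at d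
    exact d
  obtain ⟨δ, hδ, hball⟩ := Metric.eventually_nhds_iff_ball.1 htube
  refine ⟨δ, hδ, fun {p} hpD hpdist => ?_⟩
  obtain ⟨t, r⟩ := p
  obtain ⟨ht, hr⟩ := hpD
  have hr' : 0 < r := hr
  have hnear := hball (t, r) hpdist
  show dist (P t (sel t r).1 - P t (sel t r).2) (P t₁ (sel t₁ r₁).1 - P t₁ (sel t₁ r₁).2) < ε
  -- names for the extremisers
  obtain ⟨hxp, hxm⟩ := hsel t ht r hr'
  obtain ⟨hxp₁, hxm₁⟩ := hsel t₁ ht₁ r₁ hr₁'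
  set xp := (sel t r).1 with hxpdef
  set xm := (sel t r).2 with hxmdef
  set xp₁ := (sel t₁ r₁).1 with hxp₁def
  set xm₁ := (sel t₁ r₁).2 with hxm₁def
  -- unit directions
  obtain ⟨ξp, hξp, hxpe⟩ := exists_unit_eq_of_mem_sphere hr' hxp.1
  obtain ⟨ξm, hξm, hxme⟩ := exists_unit_eq_of_mem_sphere hr' hxm.1
  have hunit : ∀ {ξ : E3}, ‖ξ‖ = 1 → ξ ∈ Metric.sphere (0 : E3) 1 := fun h => by
    rw [mem_sphere_iff_norm, sub_zero]; exact h
  -- the uniform estimates at unit directions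
  have hclose : ∀ ξ : E3, ‖ξ‖ = 1 →
      ‖Φ₁ ((t, r), ξ) - Φ₁ ((t₁, r₁), ξ)‖ < ε₁ ∧ |T t (x₀ + r • ξ) - T t₁ (x₀ + r₁ • ξ)| < ε₁ :=
    fun ξ hξ => hnear ξ (hunit hξ) (hunit hξ) ⟨ht, hr⟩
  -- (c) the spherical extrema are `ε₁`-close
  have hTclose : ∀ ξ : E3, ‖ξ‖ = 1 → |T t (x₀ + r • ξ) - T t₁ (x₀ + r₁ • ξ)| ≤ ε₁ := fun ξ hξ => (hclose ξ hξ).2.le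
  have hsup := abs_sphSup_sub_le_of_forall hr' hr₁' (hTc t ht hr') (hTc t₁ ht₁ hr₁') hTclose
  have hinf := abs_sphInf_sub_le_of_forall hr' hr₁' (hTc t ht hr') (hTc t₁ ht₁ hr₁') hTclose
  -- (d) the end corrections on `S_{r₁}` by (Λ) at time `t₁`
  have hΛ₁ : ∀ {x y : E3}, x ∈ Metric.sphere x₀ r₁ → y ∈ Metric.sphere x₀ r₁ →
      |P t₁ x - P t₁ y| ≤ V t₁ * r₁ * |T t₁ x - T t₁ y| := fun hx hy =>
    abs_head_sub_le (hvs t₁ ht₁) (hTs t₁ ht₁) (hP t₁ ht₁) (hV t₁ ht₁) (hcross t₁ ht₁) (hU t₁ ht₁) hr₁' hx hy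
  have hsupv : T t xp = sphSup (T t) x₀ r := (sphSup_eq_of_mem_sphArgmax (hTc t ht hr') hxp).symm
  have hsupv₁ : T t₁ xp₁ = sphSup (T t₁) x₀ r₁ := (sphSup_eq_of_mem_sphArgmax (hTc t₁ ht₁ hr₁') hxp₁).symm
  have hinfv : ∀ {τ : ℝ} (hτ : τ ∈ Ioo t₀ 0) {ρ : ℝ} (hρ : 0 < ρ) {x : E3}, x ∈ sphArgmin (T τ) x₀ ρ →
      T τ x = sphInf (T τ) x₀ ρ := by
    intro τ hτ ρ hρ x hx
    symm
    refine IsLeast.csInf_eq ⟨⟨x, hx.1, rfl⟩, ?_⟩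
    rintro _ ⟨y, hy, rfl⟩; exact hx.2 y hy
  have hendp : |P t₁ (x₀ + r₁ • ξp) - P t₁ xp₁| ≤ V t₁ * r₁ * (2 * ε₁) := by
    refine (hΛ₁ (add_smul_mem_sphere hr₁' hξp) hxp₁.1).trans (mul_le_mul_of_nonneg_left ?_ (mul_nonneg hV₁ hr₁'.le))
    have h1 := (hclose ξp hξp).2
    rw [← hxpe, hsupv] at h1
    rw [hsupv₁]
    calc |T t₁ (x₀ + r₁ • ξp) - sphSup (T t₁) x₀ r₁|
        = |(T t₁ (x₀ + r₁ • ξp) - sphSup (T t) x₀ r) + (sphSup (T t) x₀ r - sphSup (T t₁) x₀ r₁)| := by ring_nf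
      _ ≤ |T t₁ (x₀ + r₁ • ξp) - sphSup (T t) x₀ r| + |sphSup (T t) x₀ r - sphSup (T t₁) x₀ r₁| := abs_add_le _ _
      _ ≤ ε₁ + ε₁ := add_le_add (by rw [abs_sub_comm]; exact h1.le) hsup
      _ = 2 * ε₁ := by ring
  have hendm : |P t₁ (x₀ + r₁ • ξm) - P t₁ xm₁| ≤ V t₁ * r₁ * (2 * ε₁) := by
    refine (hΛ₁ (add_smul_mem_sphere hr₁' hξm) hxm₁.1).trans (mul_le_mul_of_nonneg_left ?_ (mul_nonneg hV₁ hr₁'.le))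
    have h1 := (hclose ξm hξm).2
    rw [← hxme, hinfv ht hr' hxm] at h1
    rw [hinfv ht₁ hr₁' hxm₁]
    calc |T t₁ (x₀ + r₁ • ξm) - sphInf (T t₁) x₀ r₁|
        = |(T t₁ (x₀ + r₁ • ξm) - sphInf (T t) x₀ r) + (sphInf (T t) x₀ r - sphInf (T t₁) x₀ r₁)| := by ring_nf
      _ ≤ |T t₁ (x₀ + r₁ • ξm) - sphInf (T t) x₀ r| + |sphInf (T t) x₀ r - sphInf (T t₁) x₀ r₁| := abs_add_le _ _
      _ ≤ ε₁ + ε₁ := add_le_add (by rw [abs_sub_comm]; exact h1.le) hinf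
      _ = 2 * ε₁ := by ring
  -- (b) the oscillation of `D = P_t − P_{t₁} ∘ σ` over `S_r`
  set c : ℝ := r₁ / r with hc
  have hc0 : c ≠ 0 := div_ne_zero hr₁'.ne' hr'.ne'
  set Dfun : E3 → ℝ := fun z => P t z - P t₁ (x₀ + c • (z - x₀)) with hDfun
  have hσne : ∀ {z : E3}, z ≠ x₀ → x₀ + c • (z - x₀) ≠ x₀ := fun hz => by
    rw [Ne, add_eq_left]; exact smul_ne_zero hc0 (sub_ne_zero.2 hz)
  have hσs : ContDiff ℝ 1 fun z : E3 => x₀ + c • (z - x₀) :=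
    contDiff_const.add ((contDiff_id.sub contDiff_const).const_smul c)
  have hDs : ContDiffOn ℝ 1 Dfun ({x₀}ᶜ : Set E3) :=
    (hP t ht).sub ((hP t₁ ht₁).comp hσs.contDiffOn fun z hz => hσne hz)
  have hPd : ∀ {τ : ℝ}, τ ∈ Ioo t₀ 0 → ∀ {z : E3}, z ≠ x₀ → DifferentiableAt ℝ (P τ) z := fun hτ z hz =>
    ((hP _ hτ).differentiableOn one_ne_zero _ hz).differentiableAt (isOpen_compl_singleton.mem_nhds hz)
  have hDgrad : ∀ {z : E3}, z ≠ x₀ →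
      gradient Dfun z = gradient (P t) z - c • gradient (P t₁) (x₀ + c • (z - x₀)) := by
    intro z hz
    have h2 : DifferentiableAt ℝ (fun w => P t₁ (x₀ + c • (w - x₀))) z :=
      (hPd ht₁ (hσne hz)).comp z (hσs.differentiable one_ne_zero z)
    rw [hDfun, gradient_sub_of_differentiableAt (hPd ht hz) h2, gradient_comp_radialScaling (hPd ht₁ (hσne hz))]
  have hbound : ∀ z ∈ Metric.sphere x₀ r, ‖cross (gradient Dfun z) (z - x₀)‖ ≤ ε₁ := by
    intro z hz
    obtain ⟨ξ, hξ, rfl⟩ := exists_unit_eq_of_mem_sphere hr' hz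
    have hz0 : x₀ + r • ξ ≠ x₀ := ne_center_of_mem_sphere hr' hz
    have hσz : x₀ + c • (x₀ + r • ξ - x₀) = x₀ + r₁ • ξ := by
      rw [add_sub_cancel_left, smul_smul, hc, div_mul_cancel₀ r₁ hr'.ne']
    -- head relations at `x₀ + r ξ` (time `t`) and at `x₀ + r₁ ξ` (time `t₁`)
    have h1 := cross_gradient_eq_smul_of_head (hcross t ht (x₀ + r • ξ) hz0)
    have h2 := cross_gradient_eq_smul_of_head (hcross t₁ ht₁ (x₀ + r₁ • ξ) (ne_center_of_mem_sphere hr₁'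
      (add_smul_mem_sphere hr₁' hξ)))
    rw [add_sub_cancel_left] at h1 h2
    rw [Tao2016.cross_smul_right, Tao2016.cross_smul_right] at h2
    have h2' : cross (gradient (P t₁) (x₀ + r₁ • ξ)) ξ =
        ⟪v t₁ (x₀ + r₁ • ξ), r₁ • ξ⟫ • cross (gradient (T t₁) (x₀ + r₁ • ξ)) ξ := by
      have h3 : r₁ • cross (gradient (P t₁) (x₀ + r₁ • ξ)) ξ =
          r₁ • (⟪v t₁ (x₀ + r₁ • ξ), r₁ • ξ⟫ • cross (gradient (T t₁) (x₀ + r₁ • ξ)) ξ) := by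
        rw [h2, smul_comm]
      exact smul_right_injective E3 hr₁'.ne' h3
    have hcr : ∀ Z : E3, c • (r • Z) = r₁ • Z := fun Z => by rw [smul_smul, hc, div_mul_cancel₀ r₁ hr'.ne']
    have key : cross (gradient Dfun (x₀ + r • ξ)) (x₀ + r • ξ - x₀) = Φ₁ ((t, r), ξ) - Φ₁ ((t₁, r₁), ξ) := by
      rw [hDgrad hz0, hσz, add_sub_cancel_left, cross_sub_left', Tao2016.cross_smul_left, h1,
        Tao2016.cross_smul_right, Tao2016.cross_smul_right, h2', hcr]
      simp only [hΦ₁]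
      module
    rw [key]
    exact (hclose ξ hξ).1.le
  have hosc : |Dfun xp - Dfun xm| ≤ Real.pi * ε₁ := by
    rw [abs_le]
    constructor
    · have := sub_le_pi_mul_of_norm_cross_gradient_le hr' hDs hbound hxp.1 hxm.1
      linarith
    · exact sub_le_pi_mul_of_norm_cross_gradient_le hr' hDs hbound hxm.1 hxp.1
  -- (e) assemble
  have hDp : Dfun xp = P t xp - P t₁ (x₀ + r₁ • ξp) := by
    simp only [hDfun]; rw [hxpe, add_sub_cancel_left, smul_smul, hc, div_mul_cancel₀ r₁ hr'.ne']
  have hDm : Dfun xm = P t xm - P t₁ (x₀ + r₁ • ξm) := by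
    simp only [hDfun]; rw [hxme, add_sub_cancel_left, smul_smul, hc, div_mul_cancel₀ r₁ hr'.ne']
  rw [Real.dist_eq]
  have e : P t xp - P t xm - (P t₁ xp₁ - P t₁ xm₁) =
      (Dfun xp - Dfun xm) + (P t₁ (x₀ + r₁ • ξp) - P t₁ xp₁) - (P t₁ (x₀ + r₁ • ξm) - P t₁ xm₁) := by
    rw [hDp, hDm]; ring
  show |P t xp - P t xm - (P t₁ xp₁ - P t₁ xm₁)| < ε
  rw [e]
  calc |Dfun xp - Dfun xm + (P t₁ (x₀ + r₁ • ξp) - P t₁ xp₁) - (P t₁ (x₀ + r₁ • ξm) - P t₁ xm₁)|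
      ≤ |Dfun xp - Dfun xm + (P t₁ (x₀ + r₁ • ξp) - P t₁ xp₁)| + |P t₁ (x₀ + r₁ • ξm) - P t₁ xm₁| := abs_sub _ _
    _ ≤ (|Dfun xp - Dfun xm| + |P t₁ (x₀ + r₁ • ξp) - P t₁ xp₁|) + |P t₁ (x₀ + r₁ • ξm) - P t₁ xm₁| := by
        gcongr; exact abs_add_le _ _
    _ ≤ Real.pi * ε₁ + V t₁ * r₁ * (2 * ε₁) + V t₁ * r₁ * (2 * ε₁) := by gcongr
    _ = (Real.pi + 4 * V t₁ * r₁) * ε₁ := by ring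
    _ < (Real.pi + 4 * V t₁ * r₁ + 1) * ε₁ := by nlinarith
    _ = ε := by rw [hε₁]; field_simp

end Window

/-! ### NF-1a by name -/

/-- **NF-1a (`NetFlux.ExtremalHeadEMF`, hinge (a) of the netflux line; planner ns-idea-14, V8 P1): extremal head values and
the EMF bound on saddle-free spheres — PROVED.**  See the module docstring. [folklore] -/
theorem extremalHeadEMF : ExtremalHeadEMF := by
  intro v x₀ T P V t₀ hv hT hP hV hcross hU
  classical
  -- slice facts
  have hvs : ∀ t ∈ Ioo t₀ 0, ContDiff ℝ (⊤ : ℕ∞) (v t) := fun t ht => contDiff_slice_of_uncurry hv ht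
  have hTs : ∀ t ∈ Ioo t₀ 0, ContDiffOn ℝ (⊤ : ℕ∞) (T t) ({x₀}ᶜ : Set E3) := fun t ht => contDiffOn_slice_compl hT ht
  have hTc : ∀ t ∈ Ioo t₀ 0, ∀ {ρ : ℝ}, 0 < ρ → ContinuousOn (T t) (Metric.sphere x₀ ρ) := fun t ht ρ hρ =>
    continuousOn_sphere_of_continuousOn_compl (hTs t ht).continuousOn hρ
  -- a selection of extremisers
  have hex : ∀ t r : ℝ, t ∈ Ioo t₀ 0 → 0 < r →
      ∃ q : E3 × E3, q.1 ∈ sphArgmax (T t) x₀ r ∧ q.2 ∈ sphArgmin (T t) x₀ r := by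
    intro t r ht hr
    obtain ⟨xp, hxp⟩ := exists_mem_sphArgmax (hTc t ht hr) hr.le
    obtain ⟨xm, hxm, hmin⟩ := (isCompact_sphere x₀ r).exists_isMinOn (NormedSpace.sphere_nonempty.2 hr.le) (hTc t ht hr)
    exact ⟨(xp, xm), hxp, hxm, fun y hy => hmin hy⟩
  choose! sel hsel using hex
  have hsel' : ∀ t ∈ Ioo t₀ 0, ∀ r > 0, (sel t r).1 ∈ sphArgmax (T t) x₀ r ∧ (sel t r).2 ∈ sphArgmin (T t) x₀ r :=
    fun t ht r hr => hsel t r ht hr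
  refine ⟨fun t r => P t (sel t r).1 - P t (sel t r).2, ?_, ?_, ?_, ?_, ?_⟩
  · -- (i) choice independence
    intro t ht r hr xp hxp xm hxm
    exact head_diff_indep (hvs t ht) (hTs t ht) (hP t ht) (hV t ht) (hcross t ht) (hU t ht) hr (hsel' t ht r hr).1 hxp
      (hsel' t ht r hr).2 hxm
  · -- (ii) joint continuity
    exact continuousOn_head_diff hv hT hP hV hcross hU hsel'
  · -- (iii) local Lipschitz in `r`
    intro t ht a b ha _
    exact lipschitzOnWith_head_diff (hvs t ht) (hTs t ht) (hP t ht) (hV t ht) (hcross t ht) (hU t ht) ha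
      (fun r hr => (hsel' t ht r (ha.trans_le hr.1)).1) (fun r hr => (hsel' t ht r (ha.trans_le hr.1)).2)
  · -- (iv) the EMF bound
    intro t ht r hr
    exact abs_head_diff_le_netFlux (hvs t ht) (hTs t ht) (hP t ht) (hV t ht) (hcross t ht) (hU t ht) hr
      (hsel' t ht r hr).1 (hsel' t ht r hr).2
  · -- (v) the a.e. slope bound
    intro t ht
    exact ae_deriv_head_diff_le (hvs t ht) (hTs t ht) (hP t ht) (hV t ht) (hcross t ht) (hU t ht)
      (fun r hr => (hsel' t ht r hr).1) (fun r hr => (hsel' t ht r hr).2)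

end Summit.NavierStokesRegularity.NavierStokesRegularity.Theorems.PoloidalLiouville.NetFlux

end
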